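import Mathlib
import HarnessLib
import Literature.Analysis.FluidPDE.SuitableWeak
import Literature.Analysis.FluidPDE.SelfSimilar
import Literature.Analysis.FluidPDE.LocalTypeI
import Literature.Analysis.FluidPDE.ESSLocalHolderNoConcentration
import Summits.NavierStokesRegularity.NavierStokesRegularity.Theorems.RellichScarNoMildScar

/-!
# Unique continuation and Liouville on strips from an irrotational ball (line calm-cone-carleman, crux ApexLocalisation stmt-NavierStokesRegularity-11719, stub `stub_ballStripLiouville`)

Step S4' of the cone Liouville theorem of the line `calm-cone-carleman` (K1's interior step, cone
widening).  Setting: `(w, π)` is a suitable weak solution of the Navier–Stokes system on the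
backward slab `]-∞, 0[ × ℝ³` with a weak spatial gradient `H` and `𝐈 < ∞`; `Uf` is a jointly
continuous representative of `w` on `]-1, 0[ × B(x₁, 3)` whose curl vanishes there (`x₁ ∈ ℝ³`
arbitrary); `]a, b[ × ℝ³`, `b ≤ 0`, is a strip with `|w| ≤ L` a.e. on `]a - 4ρ², b[ × ℝ³`.
Conclusion: `w(s, ·) = 0` a.e. for a.e. `s ∈ ]a, b[`.

Proof: the template `RellichScarApexLocalisationHalfspaceStripLiouville` (itself following
`RellichScarNoMildScar.apex_strip_velocity_ae_zero`; Escauriaza–Seregin–Šverák 2003, §3 after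
(3.32) and Thm. 4.1) with the far half-space replaced by the ball `B(x₁, 3)`.  The smooth
representative `U` of `w` on the strip (Serrin's theory in the per-cylinder pressure gauge,
`exists_smooth_representative_of_locally_bounded_gauge`) has a vorticity of class `C¹₂` obeying
the differential inequality `|∂ₜω - Δω| ≤ c (|ω| + |∇ω|)` (`vorticity_carleman_inequality`); it
vanishes on `]a, b[ × B(x₁, 3)` (`U = Uf` there), hence everywhere by unique continuation through
spatial boundaries (`Carleman.uniqueContinuation_uncurried_c12`, centred at `x₁`, radius
`‖x‖ + ‖x₁‖ + 10`).  So every slice `U(t)` is a bounded `C²` field with `curl U(t) = 0`,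
`div U(t) = 0`, hence CONSTANT (Koch–Nadirashvili–Seregin–Šverák 2009, Lemma 3.1:
`eq_of_curl_eq_zero_of_isDivFree_of_bounded`), and the constant is zero by the Morrey-type bound
`∫_{B(0, η)} |w(s)|² ≤ η 𝐈` for a.e. `s ∈ ]-η², 0[` (Albritton–Barker 2019, §1:
`ae_lintegral_ball_sq_le`) along `η = n + 2 → ∞`.

* `stub_ballStripLiouville` — the statement S4'.

References: L. Escauriaza, G. Seregin, V. Šverák, *`L_{3,∞}`-solutions of Navier–Stokes equations
and backward uniqueness*, Russ. Math. Surveys 58 (2003) 211–250, §3 and Thm. 4.1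
[EscauriazaSereginSverak2003]; G. Koch, N. Nadirashvili, G. Seregin, V. Šverák, *Liouville
theorems for the Navier–Stokes equations and applications*, Acta Math. 203 (2009) 83–105,
Lemma 3.1 [KochNadirashviliSereginSverak2009]; D. Albritton, T. Barker, *Global weak Besov
solutions of the Navier–Stokes equations and applications*, ARMA 232 (2019), §1
[AlbrittonBarker2019].
-/

noncomputable section

set_option linter.dupNamespace false

namespace Summit.NavierStokesRegularity.NavierStokesRegularity.Theorems.RellichScarApexLocalisation

open MeasureTheory Set Function Metric Filter Topology TopologicalSpace
open scoped ENNReal NNReal InnerProductSpace RealInnerProductSpace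
open Literature.Analysis Literature.Analysis.FluidPDE
open Summit.NavierStokesRegularity.NavierStokesRegularity.Theorems.RellichScarNoMildScar

local notation "E³" => EuclideanSpace ℝ (Fin 3)

/-- The open backward slab `(-∞, 0) × ℝ³` (time first). -/
local notation "𝕊" => Literature.Analysis.FluidPDE.slab (EuclideanSpace ℝ (Fin 3)) (Set.Iio (0 : ℝ)) isOpen_Iio

/-! ### A constant with linearly growing `L²` mass on large balls vanishes -/

/-- **The Morrey bound kills constants.**  If a vector `c ∈ ℝ³` satisfies
`∫_{B(0, n + 2)} |c|² ≤ (n + 2) I` for every `n ∈ ℕ`, with `I < ∞`, then `c = 0`: the left side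
equals `|c|² (n + 2)³ |B(0, 1)|`, which outgrows `(n + 2) I`. [folklore] -/
private theorem ballStrip_const_eq_zero {c : E³} {I : ℝ≥0∞} (hI : I ≠ ⊤)
    (h : ∀ n : ℕ, ∫⁻ _ in ball (0 : E³) ((n : ℝ) + 2), ‖c‖ₑ ^ 2 ≤ ENNReal.ofReal ((n : ℝ) + 2) * I) :
    c = 0 := by
  by_contra hc
  have hcpos : 0 < ‖c‖ := norm_pos_iff.2 hc
  set v : ℝ := (volume (ball (0 : E³) 1)).toReal with hv
  have hvpos : 0 < v :=
    ENNReal.toReal_pos (measure_ball_pos volume (0 : E³) one_pos).ne' measure_ball_lt_top.ne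
  have hm : 0 < ‖c‖ ^ 2 * v := mul_pos (pow_pos hcpos 2) hvpos
  obtain ⟨n, hn⟩ := exists_nat_gt (I.toReal / (‖c‖ ^ 2 * v))
  rw [div_lt_iff₀ hm] at hn
  have hn2 : (0 : ℝ) < (n : ℝ) + 2 := by positivity
  have key := h n
  rw [setLIntegral_const, Measure.addHaar_ball_of_pos volume (0 : E³) hn2,
    finrank_euclideanSpace_fin] at key
  have key' := ENNReal.toReal_mono (ENNReal.mul_ne_top ENNReal.ofReal_ne_top hI) key
  rw [ENNReal.toReal_mul, ENNReal.toReal_mul, ENNReal.toReal_mul, ENNReal.toReal_pow,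
    toReal_enorm, ENNReal.toReal_ofReal (by positivity), ENNReal.toReal_ofReal hn2.le, ← hv] at key'
  have h1 : ‖c‖ ^ 2 * v * ((n : ℝ) + 2) ^ 2 ≤ I.toReal :=
    le_of_mul_le_mul_left (by linarith [key']) hn2
  have hq : (0 : ℝ) < ((n : ℝ) + 2) ^ 2 - n := by nlinarith [sq_nonneg ((n : ℝ) + 3 / 2)]
  nlinarith [mul_pos hm hq, h1, hn]

/-! ### The interior step: unique continuation and Liouville on a bounded strip -/

/-- **S4' (the interior step of ESS 2003, Thm. 1.4, far field an irrotational ball).**  Let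
`(w, π)` be a suitable weak solution on the backward slab with weak gradient `H` and `𝐈 < ∞`, let
`Uf` be a jointly continuous representative of `w` on `]-1, 0[ × B(x₁, 3)` with `curl Uf = 0`
there, and let `]a, b[ × ℝ³`, `b ≤ 0`, be a strip with `|w| ≤ L` a.e. on `]a - 4ρ², b[ × ℝ³`.
Then `w(s, ·) = 0` a.e. for a.e. `s ∈ ]a, b[`: the smooth representative on the strip has
vorticity of class `C¹₂` with the Carleman differential inequality, vanishing on
`]a, b[ × B(x₁, 3)`, hence identically by unique continuation through spatial boundaries (centred
at `x₁`, radius `‖x‖ + ‖x₁‖ + 10` reaching the target point `x`); each slice is then a bounded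
field with `curl = 0`, `div = 0`, hence constant (KNSS 2009, Lemma 3.1), and the constant vanishes
by the bound `∫_{B(0,η)} |w(s)|² ≤ η 𝐈`, `η → ∞`.
[cite: EscauriazaSereginSverak2003, §3 after (3.32) and Thm. 4.1]
[cite: KochNadirashviliSereginSverak2009, Lemma 3.1] [cite: AlbrittonBarker2019, §1] -/
theorem stub_ballStripLiouville :
    ∀ (x₁ : E³) (w : ℝ → E³ → E³) (π : ℝ → E³ → ℝ) (H : ℝ → E³ → E³ →L[ℝ] E³) (Uf : ℝ → E³ → E³),
      IsSuitableWeakSolutionOn 𝕊 1 0 w π → HasWeakSpatialGradientOn 𝕊 w H →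
      typeIBound (Iio (0 : ℝ) ×ˢ univ) w π H < ⊤ →
      uncurry Uf =ᵐ[volume.restrict (Ioo (-1 : ℝ) 0 ×ˢ ball x₁ 3)] uncurry w →
      ContinuousOn (uncurry Uf) (Ioo (-1 : ℝ) 0 ×ˢ ball x₁ 3) →
      (∀ z ∈ Ioo (-1 : ℝ) 0 ×ˢ ball x₁ 3, curl (Uf z.1) z.2 = 0) →
      ∀ (a b ρ L : ℝ), 0 < ρ → -1 ≤ a - 4 * ρ ^ 2 → b ≤ 0 →
      (∀ᵐ z ∂(volume.restrict (Ioo (a - 4 * ρ ^ 2) b ×ˢ (univ : Set E³))), ‖w z.1 z.2‖ ≤ L) →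
      ∀ᵐ s ∂(volume.restrict (Ioo a b)), w s =ᵐ[volume] 0 := by
  intro x₁ w π H Uf hsw _ hI hUf hUfc hcurl a b ρ L hρ ha hb hbd
  set I₀ : ℝ≥0∞ := typeIBound (Iio (0 : ℝ) ×ˢ (univ : Set E³)) w π H with hI₀def
  have hI₀top : I₀ ≠ ⊤ := hI.ne
  -- ### the representative on the strip
  set I : Set ℝ := Ioo a b with hIdef
  have hIo : IsOpen I := isOpen_Ioo
  set Ω : Set (ℝ × E³) := I ×ˢ (univ : Set E³) with hΩdef
  have hΩo : IsOpen Ω := hIo.prod isOpen_univ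
  have hIsub : I ⊆ Ioo (-1 : ℝ) 0 := Ioo_subset_Ioo (by nlinarith [sq_nonneg ρ]) hb
  set P : ℝ≥0 := (ENNReal.ofReal (2 * ρ) ^ 2 * I₀).toNNReal with hP
  have hPeq : ((P : ℝ≥0) : ℝ≥0∞) = ENNReal.ofReal (2 * ρ) ^ 2 * I₀ :=
    ENNReal.coe_toNNReal (ENNReal.mul_ne_top (ENNReal.pow_ne_top ENNReal.ofReal_ne_top) hI₀top)
  have hloc : ∀ z ∈ Ioo a b ×ˢ (univ : Set E³), ∃ πz : ℝ → E³ → ℝ,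
      IsDistributionalNSSolutionOn
        (parabolicCylinderOpens (2 * ρ) (min (z.1 + ρ ^ 2) b, z.2)) 1 0 w πz ∧
      (∀ᵐ q ∂(volume.restrict (parabolicCylinder (2 * ρ) (min (z.1 + ρ ^ 2) b, z.2))),
        ‖w q.1 q.2‖ ≤ L) ∧
      ∫⁻ q in parabolicCylinder (2 * ρ) (min (z.1 + ρ ^ 2) b, z.2), ‖πz q.1 q.2‖ₑ ^ (3 / 2 : ℝ) ≤ P := by
    rintro ⟨t, x⟩ ⟨ht, -⟩
    set z₀ : ℝ × E³ := (min (t + ρ ^ 2) b, x) with hz₀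
    have hz₀t : z₀.1 ≤ 0 := (min_le_right _ _).trans hb
    refine ⟨fun s y => π s y - ⨍ y' in ball z₀.2 (2 * ρ), π s y', ?_, ?_, ?_⟩
    · exact ((sub_ballMean_slab hsw z₀.2 (by positivity : (0 : ℝ) < 2 * ρ)).of_le
        (parabolicCylinderOpens_le_slab _ hz₀t)).distributional
    · have hcyl : parabolicCylinder (2 * ρ) z₀ ⊆ Ioo (a - 4 * ρ ^ 2) b ×ˢ (univ : Set E³) := by
        rintro ⟨s, y⟩ hq
        rw [mem_parabolicCylinder] at hq
        obtain ⟨⟨hs1, hs2⟩, -⟩ := hq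
        refine ⟨⟨?_, lt_of_lt_of_le hs2 (min_le_right _ _)⟩, mem_univ _⟩
        have h1 : a < min (t + ρ ^ 2) b := lt_min (by linarith [ht.1, sq_nonneg ρ]) (ht.1.trans ht.2)
        have h2 : z₀.1 = min (t + ρ ^ 2) b := rfl
        rw [h2] at hs1
        nlinarith
      exact ae_restrict_of_ae_restrict_of_subset hcyl hbd
    · rw [hPeq]
      exact lintegral_sub_ballMean_le_typeIBound (by positivity) hz₀t w π H
  obtain ⟨K, U, hUw, hUc, hCD, hjc, hbdK⟩ := exists_smooth_representative_of_locally_bounded_gauge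
    NSBoundedHigherRegularityBounds_holds isOpen_univ hρ hloc 4
  -- the equations hold for the representative
  have hΩle : (⟨Ω, hΩo⟩ : Opens (ℝ × E³)) ≤ (slab E³ (Iio (0 : ℝ)) isOpen_Iio) := by
    intro z hz
    rw [mem_slab]
    exact (hIsub hz.1).2
  have hsolw : IsDistributionalNSSolutionOn ⟨Ω, hΩo⟩ 1 0 w π := (hsw.of_le hΩle).distributional
  have hsol : IsDistributionalNSSolutionOn ⟨Ω, hΩo⟩ 1 0 U π :=
    hsolw.congr_ae hUw.symm (ae_of_all _ fun _ => rfl)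
  have hU4 : ∀ t ∈ I, ContDiffOn ℝ 4 (U t) (univ : Set E³) := fun t ht x _ =>
    ((hCD (t, x) ⟨ht, mem_univ _⟩).of_le (by norm_cast)).contDiffWithinAt
  have hΦ : ∀ n ≤ 4, ContinuousOn (fun z : ℝ × E³ => iteratedFDeriv ℝ n (U z.1) z.2) Ω := fun n _ => hjc n
  have hK₀ : ∀ z ∈ Ω, ‖U z.1 z.2‖ ≤ K := fun z hz => by
    have h := hbdK 0 (by norm_num) z hz
    rwa [norm_iteratedFDeriv_zero] at h
  have hK₁ : ∀ z ∈ Ω, ‖fderiv ℝ (U z.1) z.2‖ ≤ K := fun z hz => by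
    have h := hbdK 1 (by norm_num) z hz
    rwa [norm_iteratedFDeriv_one] at h
  -- ### the vorticity: class `C¹₂`, equation, vanishing on the ball
  obtain ⟨hdiv, -, -, hω1, hωx⟩ := vorticity_c12_of_isDistributionalNSSolutionOn hIo isOpen_univ hsol hU4 hΦ
  obtain ⟨-, -, hineq⟩ := vorticity_carleman_inequality hIo isOpen_univ hsol hU4 hΦ hK₀ hK₁
  have hωbd : ∀ z ∈ Ω, ‖(uncurry (vorticity U)) z‖ ≤ ‖curlCLM‖ * K := fun z hz => by
    show ‖vorticity U z.1 z.2‖ ≤ _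
    rw [vorticity_apply]
    exact (norm_curl_le _ _).trans (mul_le_mul_of_nonneg_left (hK₁ z hz) (ContinuousLinearMap.opNorm_nonneg curlCLM))
  have hfarΩ : ∀ z ∈ I ×ˢ ball x₁ 3, vorticity U z.1 z.2 = 0 := by
    set O : Set (ℝ × E³) := I ×ˢ ball x₁ 3 with hO
    have hOo : IsOpen O := hIo.prod isOpen_ball
    have hOΩ : O ⊆ Ω := prod_mono Subset.rfl (subset_univ _)
    have hOF : O ⊆ Ioo (-1 : ℝ) 0 ×ˢ ball x₁ 3 := prod_mono hIsub Subset.rfl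
    have hae1 : uncurry U =ᵐ[volume.restrict O] uncurry w := ae_restrict_of_ae_restrict_of_subset hOΩ hUw
    have hae2 : uncurry Uf =ᵐ[volume.restrict O] uncurry w := ae_restrict_of_ae_restrict_of_subset hOF hUf
    have hae : uncurry U =ᵐ[volume.restrict O] uncurry Uf := hae1.trans hae2.symm
    have heqOn : EqOn (uncurry U) (uncurry Uf) O :=
      Measure.eqOn_open_of_ae_eq hae hOo (hUc.mono hOΩ) (hUfc.mono hOF)
    rintro ⟨t, x⟩ ⟨ht, hx⟩
    have hev : U t =ᶠ[𝓝 x] Uf t := slice_eventuallyEq hOo heqOn (w := (t, x)) ⟨ht, hx⟩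
    show vorticity U t x = 0
    rw [vorticity_apply, curl_eq_curlCLM, hev.fderiv_eq, ← curl_eq_curlCLM]
    exact hcurl (t, x) ⟨hIsub ht, hx⟩
  -- ### unique continuation from the ball, at every time of the strip
  have hωzero : ∀ t ∈ I, ∀ x : E³, vorticity U t x = 0 := by
    intro t ht x
    have hK0 : 0 ≤ K := (norm_nonneg _).trans (hK₀ (t, 0) ⟨ht, mem_univ _⟩)
    set Rb : ℝ := ‖x‖ + ‖x₁‖ + 10 with hRb
    have hRbpos : 0 < Rb := by positivity
    set T' : ℝ := t - a with hT'
    have hT'pos : 0 < T' := by have := ht.1; simp only [hT']; linarith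
    set A : ℝ × E³ → ℝ × E³ := stAffine (-1) 1 t x₁ with hAdef
    have hA1 : ∀ z : ℝ × E³, (A z).1 = t - z.1 := fun z => by
      show t + (-1) * z.1 = t - z.1; ring
    have hA2 : ∀ z : ℝ × E³, (A z).2 = x₁ + z.2 := fun z => by
      show x₁ + (1 : ℝ) • z.2 = x₁ + z.2; rw [one_smul]
    set Q' : Set (ℝ × E³) := Ioo (0 : ℝ) T' ×ˢ ball (0 : E³) Rb with hQ'
    have hAΩ' : ∀ z ∈ Ico (0 : ℝ) T' ×ˢ ball (0 : E³) Rb, A z ∈ Ω := by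
      rintro ⟨s, y⟩ ⟨hs, -⟩
      refine ⟨?_, mem_univ _⟩
      rw [hA1]
      have h1 := hs.1
      have h2 := hs.2
      simp only [hT'] at h2
      exact ⟨by simp only; linarith, by simp only; linarith [ht.2]⟩
    have hAΩ : ∀ z ∈ Q', A z ∈ Ω := fun z hz => hAΩ' z ⟨Ioo_subset_Ico_self hz.1, hz.2⟩
    set ω : ℝ × E³ → E³ := uncurry (vorticity U) with hωdef
    set uu : ℝ × E³ → E³ := fun z => ω (A z) with hudef
    have hu1 : ContDiffOn ℝ 1 uu Q' :=
      (Carleman.contDiffOn_comp_stAffine hω1 (-1) 1 t x₁).mono fun z hz => hAΩ z hz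
    have hdxu : ∀ e' : E³, Carleman.dx e' uu = fun z => Carleman.dx e' ω (A z) := by
      intro e'
      funext z
      rw [hudef, Carleman.dx_comp_stAffine (by norm_num) one_ne_zero ω e' z, one_smul]
    have hux : ∀ e' : E³, ContDiffOn ℝ 1 (Carleman.dx e' uu) Q' := by
      intro e'
      rw [hdxu e']
      exact (Carleman.contDiffOn_comp_stAffine (hωx e') (-1) 1 t x₁).mono fun z hz => hAΩ z hz
    have hucont : ContinuousOn uu (Ico (0 : ℝ) T' ×ˢ ball (0 : E³) Rb) :=
      (Carleman.continuousOn_comp_stAffine hω1.continuousOn (-1) 1 t x₁).mono fun z hz => hAΩ' z hz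
    have hdtu : ∀ z, Carleman.dt uu z = (-1 : ℝ) • Carleman.dt ω (A z) := fun z => by
      rw [hudef, Carleman.dt_comp_stAffine (by norm_num) one_ne_zero]
    have hlapu : ∀ z, Carleman.lap uu z = Carleman.lap ω (A z) := fun z => by
      rw [hudef, Carleman.lap_comp_stAffine (by norm_num) one_ne_zero, one_pow, one_smul]
    have hgradu : ∀ z, Carleman.gradSq uu z = Carleman.gradSq ω (A z) := fun z => by
      rw [hudef, Carleman.gradSq_comp_stAffine (by norm_num) one_ne_zero, one_pow, one_mul]
    have hinequ : ∀ z ∈ Q', ‖Carleman.dt uu z + Carleman.lap uu z‖ ≤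
        (K + K) * (‖uu z‖ + Real.sqrt (Carleman.gradSq uu z)) := by
      intro z hz
      rw [hdtu z, hlapu z, hgradu z]
      have e1 : (-1 : ℝ) • Carleman.dt ω (A z) + Carleman.lap ω (A z) =
          -(Carleman.dt ω (A z) - Carleman.lap ω (A z)) := by
        rw [neg_one_smul]; abel
      rw [e1, norm_neg]
      exact hineq (A z) (hAΩ z hz)
    have hvan : ∀ k : ℕ, ∃ C₀ : ℝ, ∀ z ∈ Q', ‖uu z‖ ≤ C₀ * (‖z.2‖ + Real.sqrt z.1) ^ k := by
      intro k
      refine ⟨‖curlCLM‖ * K, fun z hz => ?_⟩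
      have hbase : 0 ≤ ‖z.2‖ + Real.sqrt z.1 := by positivity
      by_cases hy : ‖z.2‖ < 2
      · have hfar' : x₁ + z.2 ∈ ball x₁ 3 := by
          rw [mem_ball_iff_norm, add_sub_cancel_left]
          linarith
        have h0 : uu z = 0 := by
          have h := hfarΩ (A z) ⟨(hAΩ z hz).1, by rw [hA2]; exact hfar'⟩
          show ω (A z) = 0
          exact h
        rw [h0, norm_zero]
        positivity
      · push Not at hy
        have h1 : (1 : ℝ) ≤ (‖z.2‖ + Real.sqrt z.1) ^ k :=
          one_le_pow₀ (by linarith [Real.sqrt_nonneg z.1])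
        calc ‖uu z‖ = ‖ω (A z)‖ := rfl
          _ ≤ ‖curlCLM‖ * K := hωbd _ (hAΩ z hz)
          _ = ‖curlCLM‖ * K * 1 := (mul_one _).symm
          _ ≤ ‖curlCLM‖ * K * (‖z.2‖ + Real.sqrt z.1) ^ k :=
              mul_le_mul_of_nonneg_left h1 (by positivity)
    have huc := Carleman.uniqueContinuation_uncurried_c12 3 3 (c₁ := K + K) (R := Rb) (T := T')
      (by positivity) hRbpos hT'pos hu1 hux hucont hinequ hvan
    have hy : x - x₁ ∈ ball (0 : E³) Rb := by
      rw [mem_ball_zero_iff]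
      calc ‖x - x₁‖ ≤ ‖x‖ + ‖x₁‖ := norm_sub_le _ _
        _ < Rb := by rw [hRb]; linarith
    have h := huc (x - x₁) hy
    have hA0 : A (0, x - x₁) = (t, x) := by
      show (t + (-1) * (0 : ℝ), x₁ + (1 : ℝ) • (x - x₁)) = (t, x)
      simp
    have h' : ω (A (0, x - x₁)) = 0 := h
    rw [hA0] at h'
    exact h'
  -- ### the velocity slices are bounded, curl-free and divergence-free, hence constant
  have hconst : ∀ t ∈ I, ∀ y : E³, U t y = U t 0 := by
    intro t ht y
    have hcd : ContDiff ℝ 2 (U t) := contDiff_iff_contDiffAt.2 fun y =>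
      (hCD (t, y) ⟨ht, mem_univ _⟩).of_le (by norm_cast)
    exact eq_of_curl_eq_zero_of_isDivFree_of_bounded hcd
      (fun y => by rw [← vorticity_apply]; exact hωzero t ht y)
      (fun y => hdiv (t, y) ⟨ht, mem_univ _⟩) (fun y => hK₀ (t, y) ⟨ht, mem_univ _⟩) y 0
  -- ### a.e. slice: `U(t) = w(t)` a.e. and the Morrey bound `∫_{B(0,η)} |w(t)|² ≤ η 𝐈`
  have hslice : ∀ᵐ t ∂(volume.restrict I), U t =ᵐ[volume] w t := by
    have h1 : ∀ᵐ z ∂((volume.restrict I).prod (volume : Measure E³)), uncurry U z = uncurry w z := by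
      rw [Measure.restrict_prod_eq_prod_univ, ← Measure.volume_eq_prod]
      exact hUw
    filter_upwards [Measure.ae_ae_of_ae_prod h1] with t ht
    filter_upwards [ht] with x hx
    exact hx
  have hMorrey : ∀ᵐ t ∂(volume.restrict I), ∀ n : ℕ,
      ∫⁻ y in ball (0 : E³) ((n : ℝ) + 2), ‖w t y‖ₑ ^ 2 ≤ ENNReal.ofReal ((n : ℝ) + 2) * I₀ := by
    rw [ae_all_iff]
    intro n
    have hn : (0 : ℝ) < (n : ℝ) + 2 := by positivity
    have hsub : I ⊆ Ioo (-((n : ℝ) + 2) ^ 2) 0 :=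
      hIsub.trans (Ioo_subset_Ioo_left (by nlinarith))
    exact ae_restrict_of_ae_restrict_of_subset hsub (ae_lintegral_ball_sq_le (I := I₀) le_rfl hn)
  filter_upwards [ae_restrict_mem measurableSet_Ioo, hslice, hMorrey] with t ht hUt hMt
  have hc0 : U t 0 = 0 := by
    refine ballStrip_const_eq_zero hI₀top fun n => ?_
    calc ∫⁻ _ in ball (0 : E³) ((n : ℝ) + 2), ‖U t 0‖ₑ ^ 2
        = ∫⁻ y in ball (0 : E³) ((n : ℝ) + 2), ‖w t y‖ₑ ^ 2 := by
          refine lintegral_congr_ae ?_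
          filter_upwards [ae_restrict_of_ae hUt] with y hy
          rw [← hy, hconst t ht y]
      _ ≤ ENNReal.ofReal ((n : ℝ) + 2) * I₀ := hMt n
  have hU0 : U t = 0 := funext fun y => (hconst t ht y).trans hc0
  filter_upwards [hUt] with x hx
  rw [← hx, hU0]

end Summit.NavierStokesRegularity.NavierStokesRegularity.Theorems.RellichScarApexLocalisation

end
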